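import Mathlib

/-!
# One-point squeeze (crux `TwinAlgMuZeroAtThree`, item 24737) — U1-loc: SIGNED TWIST-ACYCLICITY (utd-idea g69)

Model file (pure algebra over Mathlib, sorry-free) for the new sub-crux **U1-loc** of the live crux idea
`Cruxes/TwinAlgMuZeroAtThree/Ideas/one-point-squeeze.md` (lineage bsd-wall-utd-idea; companion of
`Sketch_utd_idea_g65.lean` §§13–14, namespace `...OnePointSqueeze`).

## The issue (U1-loc)

Howard's DVR Kolyvagin bound (tree: `Literature.NumberTheory.GaloisCohomology.Howard2004.thm161_dvrKolyvaginBound`,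
abstract DVR `R ⊇ ℤ_[p]`, error-free) is invoked on the χ-twisted Heegner data `(T_χ, F_BK, 𝓛)` over `O_χ = ℤ₃[ζ_{3^m}]`.
Its `KolyvaginSystem.ks` field needs the derivative classes `κ_n ∈ H¹(K, T_χ/I_n T_χ)` to satisfy the local condition
at `w ∣ 3` PROPAGATED from `H¹_f(K_𝔭, T_χ)` (`SatisfiesH.cond_red`), whereas Heegner-point classes a priori satisfy
the KUMMER condition (restriction to `L = K_m·K[n]` comes from points).  With `M_L := Ê′(𝔪_{L_w̃})` (torsion-free,
no local 3-torsion) and `D = Gal(L_w̃/K_𝔭) = G_m × C_n` the discrepancy is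
`F′_n / F_n ≅ H¹(D, M_L ⊗ O_χ(χ))[I_n]`.
In Gross's untwisted setting `D` is unramified and this group is `0`; here `χ` is ramified of order `3^m` at `𝔭` and
`H¹(G_m, Ê′(𝔪_{K_{m,w}}) ⊗ O_χ(χ))` has `O_χ`-length `= #Ĥ⁰ =` (isotypic line : resolvent line) `=` the Kobayashi defect
`d_χ ≈ kobDefect 3 m ≤ (3/8)·φ(3^m)` (g65 §13) — linear in `φ(3^m)`, and `I_n = 3^s O_χ = π^{s φ(3^m)}` is deep, so the
whole group is `I_n`-torsion.  Any loss linear in `φ(3^m)` is fatal for the squeeze only if it exceeds the budget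
`c′ < 1/4` of `TwistedKolyvaginWithKobayashiDefectAtThree` (g65 §13), but the point of this file is that on the
SIGNED part there is NO loss at all.

## What is proved here (kernel-checked, no `sorry`)

Model (Kobayashi, `a₃ = 0`): `Ê′(𝔪_{K_{m,w}}) ⊗ ℤ₃ ⊇ N⁺ ⊕ N⁻` up to the level-0 line, with
`N^ε ≅ ℤ₃[X]/(ω^ε)`, `ω^ε = ∏_{k ∈ S_ε} Φ_{3^k}(1+X)`, `S_ε` = the levels `k ≤ m` of parity `ε`, `γ ↦ 1+X`.
Twisting by a primitive character `χ` of level `m` (`χ(γ) = ζ`, `ζ` a primitive `3^m`-th root of unity) turns the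
generator into `u = ζ⁻¹(1+X)` acting on `A := O_χ[X]/(ω)`, and for the cyclic group `G_m = ⟨γ⟩`,
`H¹(G_m, A(χ)) = ker(ν)/(u−1)A` with `ν = Σ_{i<3^m} u^i`.

* `signedTwistAcyclic` (abstract form): `O` a domain, `(n : O) ≠ 0`, `ζ ζi = 1`, `ζi^n = 1`, `(X − C(ζ−1)) ∣ ω`,
  `ω ∣ (X+1)^n − 1`.  Then every `a : O[X]` with `ω ∣ ν·a` is `(u − 1)·b` on the nose.  (Proof: write
  `a = (X−(ζ−1))q + C a₀`; then `ω ∣ a₀ ν`; evaluate at `ζ − 1`, where `ν(ζ−1) = n`: `a₀ n = 0`.)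
* `signedTwistAcyclic_quot`: the same in `A = O[X] ⧸ (ω)`: `ν̄·a = 0 → a ∈ (ū − 1)A`, i.e. `H¹(G_m, A(χ)) = 0`.
* `signedOmega_dvd`, `X_sub_C_dvd_signedOmega`: the hypotheses hold for `ω = signedOmega S = ∏_{k∈S} Φ_{3^k}(1+X)`
  whenever `S ⊆ {0,…,m}` and `m ∈ S` (the signed part CONTAINING the level of `χ`), `n = 3^m`;
  `signedTwistAcyclic_level` packages it: **the ε(m)-signed local points are cohomologically invisible to the
  primitive characters of level m**.
* `twistNorm_dvd_of_level_absent` + `span_twistGen_sub_one_eq`: if instead `ω·(X − C(ζ−1)) ∣ (X+1)^n − 1` (level `m`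
  ABSENT from `S`), then `ν̄ = 0` on `A`, so `H¹(G_m, A(χ)) = A/(u−1)A ≅ O ⧸ (ω(ζ−1))` (`quotTwistEquiv`), a cyclic
  module of length `v_π(ω(ζ−1)) = Σ_{k∈S} φ(3^k)` over `O_χ` (each lower-level root costs valuation one:
  g65 §14 `norm_prod_sub_lower_level_roots`) — for `S = S_{−ε(m)}` this is exactly `kobDefect 3 m`.
* `kuriharaExponent_succ_sub` (print cross-check of the defect bookkeeping): Kurihara's closed form
  `e_n = Σ_{1≤k<n, k≢n (2)} p^k − ⌊n/2⌋` for `#Ш(E/ℚ_n)[p^∞] = p^{e_n}` in the minimal supersingular cyclotomic case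
  [Kurihara, Invent. Math. 149 (2002), Thm 0.1(3), Rem 0.2: `e_n = [μ pⁿ + λ n]`, `μ = p/(p²−1)`, `λ = −1/2`;
  corpus key paper:url-3e548eeedfb3 pp. 2–3] satisfies `e_{n+1} − e_n = kobDefect p (n+1)` for every prime `p`:
  the per-primitive-character increment of the Bloch–Kato Ш is the Kobayashi defect on the nose, and
  `lim kobDefect(p,n)/φ(pⁿ) = p/(p²−1) = μ_Kurihara` (at `p = 3`: `3/8`, the constant of g65 `two_mul_kobDefect_three_le`).

## Consequences recorded on the card (prose; not kernel objects)

U1 splits as U1-glob (Howard's H.0–H.5 for `T_χ`, audited at `p = 3` in `AuditKSHypothesesAtThree-g53.md`; Howard's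
theorem is typed over an arbitrary DVR, and `kolyvaginPrimes` is `χ`-uniform because `χ(Frob_λ) = 1`) and
U1-loc = (a′) the Kobayashi–Kim structure of `Ê′(𝔪)` over the composite local tower `K_{m,w}·(unramified)`
INCLUDING the unramified directions `C_n` (so that `H¹(D, N^ε_L ⊗ O_χ(χ)) = H¹(G_m, N^ε ⊗ O_χ(χ))` by
inflation–restriction; print: the anticyclotomic local ± conditions at a split `p` with `a_p = 0` are Λ-cofree of
rank one, Kim 2007/2014 as quoted in Hatley–Lei–Vigni arXiv:2003.10301 Prop. 3.2; unramified base: B. D. Kim,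
J. Aust. Math. Soc. 95 (2013) doi:10.1017/s1446788713000165, Kitajima–Otsuki arXiv:1607.03612) + (b) THIS FILE +
(c) the isotypic derivative classes live in the `ε(m)`-part: they are built from the plus/minus Heegner points
`z^±` whose trace relations (`a_p = 0`, Perrin-Riou) put them in `E^±(K_m)` [Longo–Vigni, BUMI 2019
doi:10.1007/s40574-018-0162-4; Hatley–Lei–Vigni arXiv:2003.10301 Def. 4.3, p. 9, `p` any odd prime].  Hence on the
ISOTYPIC road (g65 §14) Howard applies verbatim — no defect, no local discrepancy — modulo the ports (a′), (c);
the RESOLVENT classes are `r·`(isotypic) with `v_π(r) = kobDefect 3 m + O(1)`, so they satisfy the propagated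
condition too and g65 §13's `2·d_χ` is just Howard's bound for that imprimitive Kolyvagin system.
Bucket B (multiplicative): the analogous group is `H¹(G_m, U¹_{K_{m,w}} ⊗ O_χ(χ))` = (isotypic units : unit
resolvents) — size not derived here (ask F7); B is covered by the LEAD's Λ-adic Greenberg-condition road anyway.
-/

namespace Summit.BirchSwinnertonDyer.BirchSwinnertonDyer.Cruxes.TwinAlgMuZeroAtThree.OnePointSqueeze.SignedAcyclicity

open Polynomial Finset

variable {O : Type*} [CommRing O]

/-! ## §1 The twisted generator and norm element -/

/-- The twisted generator `u = ζ⁻¹·(1+X)` (`ζi` plays `ζ⁻¹`): the action of `γ` on `O[X]/(ω) ⊗ O(χ)`, `χ(γ) = ζ`,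
in the convention where the untwisted action is `γ ↦ 1 + X` (the sign/inverse convention is immaterial). -/
noncomputable def twistGen (ζi : O) : O[X] := C ζi * (X + 1)

/-- The twisted norm element `ν = Σ_{i<n} u^i`. -/
noncomputable def twistNorm (ζi : O) (n : ℕ) : O[X] := ∑ i ∈ range n, twistGen ζi ^ i

theorem twistNorm_mul_sub_one (ζi : O) (n : ℕ) :
    twistNorm ζi n * (twistGen ζi - 1) = twistGen ζi ^ n - 1 :=
  geom_sum_mul _ _

theorem twistGen_pow_eq {ζi : O} {n : ℕ} (h : ζi ^ n = 1) : twistGen ζi ^ n = (X + 1) ^ n := by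
  simp [twistGen, mul_pow, ← C_pow, h]

theorem twistGen_sub_one {ζ ζi : O} (h : ζ * ζi = 1) :
    twistGen ζi - 1 = C ζi * (X - C (ζ - 1)) := by
  have h' : C ζi * C (ζ - 1) = (1 : O[X]) - C ζi := by
    rw [← C_mul, ← C_1, ← C_sub]
    congr 1
    linear_combination h
  simp only [twistGen]
  linear_combination h'

theorem C_mul_twistGen_sub_one {ζ ζi : O} (h : ζ * ζi = 1) :
    C ζ * (twistGen ζi - 1) = X - C (ζ - 1) := by
  rw [twistGen_sub_one h, ← mul_assoc, ← C_mul, h, C_1, one_mul]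

theorem twistNorm_eval {ζ ζi : O} (h : ζ * ζi = 1) (n : ℕ) :
    (twistNorm ζi n).eval (ζ - 1) = n := by
  have h' : ζi * ζ = 1 := by rw [mul_comm]; exact h
  simp [twistNorm, twistGen, eval_finsetSum, h']

/-- `u^n ≡ 1 (mod ω)`: the twisted action factors through the cyclic group of order `n`. -/
theorem dvd_twistGen_pow_sub_one {ζi : O} {n : ℕ} (h : ζi ^ n = 1) {ω : O[X]} (hω : ω ∣ (X + 1) ^ n - 1) :
    ω ∣ twistGen ζi ^ n - 1 := by
  rwa [twistGen_pow_eq h]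

/-! ## §2 Signed twist-acyclicity (level of `χ` present in the signed part) -/

/-- **Signed twist-acyclicity**, polynomial form.  If the level of the character is a root of `ω`
(`(X − C(ζ−1)) ∣ ω`) then every `ν`-torsion element of `O[X]/(ω)` is a `(u−1)`-multiple — even before
reducing mod `ω`. -/
theorem signedTwistAcyclic [IsDomain O] {n : ℕ} (hn : (n : O) ≠ 0) {ζ ζi : O} (hζ : ζ * ζi = 1)
    (hζn : ζi ^ n = 1) {ω : O[X]} (hroot : (X - C (ζ - 1)) ∣ ω) (hω : ω ∣ (X + 1) ^ n - 1)
    {a : O[X]} (ha : ω ∣ twistNorm ζi n * a) :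
    ∃ b : O[X], a = (twistGen ζi - 1) * b := by
  -- division by the monic linear factor `X − C(ζ−1)`
  obtain ⟨q, a₀, hq⟩ : ∃ q : O[X], ∃ a₀ : O, a = (X - C (ζ - 1)) * q + C a₀ := by
    refine ⟨a /ₘ (X - C (ζ - 1)), a.eval (ζ - 1), ?_⟩
    have e := modByMonic_add_div a (X - C (ζ - 1))
    rw [modByMonic_X_sub_C_eq_C_eval] at e
    linear_combination -e
  -- the `q`-part is killed by `ω`
  have h1 : ω ∣ twistNorm ζi n * ((X - C (ζ - 1)) * q) := by
    have key : twistNorm ζi n * ((X - C (ζ - 1)) * q) = C ζ * q * ((X + 1) ^ n - 1) := by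
      calc twistNorm ζi n * ((X - C (ζ - 1)) * q)
          = twistNorm ζi n * ((C ζ * (twistGen ζi - 1)) * q) := by rw [C_mul_twistGen_sub_one hζ]
        _ = C ζ * q * (twistNorm ζi n * (twistGen ζi - 1)) := by ring
        _ = C ζ * q * (twistGen ζi ^ n - 1) := by rw [twistNorm_mul_sub_one]
        _ = C ζ * q * ((X + 1) ^ n - 1) := by rw [twistGen_pow_eq hζn]
    rw [key]
    exact dvd_mul_of_dvd_right hω _
  -- hence `ω ∣ a₀·ν`, and evaluating at the root `ζ − 1` of `ω` gives `a₀·n = 0`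
  have h2 : ω ∣ twistNorm ζi n * C a₀ := by
    have e : twistNorm ζi n * C a₀ = twistNorm ζi n * a - twistNorm ζi n * ((X - C (ζ - 1)) * q) := by
      rw [hq]; ring
    rw [e]
    exact dvd_sub ha h1
  have h3 : (twistNorm ζi n * C a₀).eval (ζ - 1) = 0 := by
    obtain ⟨r, hr⟩ := dvd_trans hroot h2
    rw [hr]
    simp
  rw [eval_mul, eval_C, twistNorm_eval hζ] at h3
  have ha₀ : a₀ = 0 := by
    rcases mul_eq_zero.mp h3 with h | h
    · exact absurd h hn
    · exact h
  refine ⟨C ζ * q, ?_⟩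
  rw [hq, ha₀, map_zero, add_zero]
  calc (X - C (ζ - 1)) * q = (C ζ * (twistGen ζi - 1)) * q := by rw [C_mul_twistGen_sub_one hζ]
    _ = (twistGen ζi - 1) * (C ζ * q) := by ring

/-- **Signed twist-acyclicity**, quotient form: in `A = O[X] ⧸ (ω)` the kernel of the twisted norm `ν̄` is
`(ū − 1)·A`, i.e. `H¹(ℤ/n, A(χ)) = ker ν̄ / (ū−1)A = 0`. -/
theorem signedTwistAcyclic_quot [IsDomain O] {n : ℕ} (hn : (n : O) ≠ 0) {ζ ζi : O} (hζ : ζ * ζi = 1)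
    (hζn : ζi ^ n = 1) {ω : O[X]} (hroot : (X - C (ζ - 1)) ∣ ω) (hω : ω ∣ (X + 1) ^ n - 1)
    (a : O[X] ⧸ Ideal.span {ω})
    (ha : Ideal.Quotient.mk (Ideal.span {ω}) (twistNorm ζi n) * a = 0) :
    ∃ b : O[X] ⧸ Ideal.span {ω}, a = Ideal.Quotient.mk (Ideal.span {ω}) (twistGen ζi - 1) * b := by
  obtain ⟨a', rfl⟩ := Ideal.Quotient.mk_surjective a
  rw [← map_mul, Ideal.Quotient.eq_zero_iff_mem, Ideal.mem_span_singleton] at ha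
  obtain ⟨b', hb'⟩ := signedTwistAcyclic hn hζ hζn hroot hω ha
  exact ⟨Ideal.Quotient.mk _ b', by rw [← map_mul, hb']⟩

/-! ## §3 The complementary case (level of `χ` absent): `ν̄ = 0` and `H¹ = A/(u−1)A ≅ O/(ω(ζ−1))` -/

/-- If the level of `χ` is NOT among the roots of `ω` in the strong sense `ω·(X − C(ζ−1)) ∣ (X+1)^n − 1`,
then `ω ∣ ν`: the twisted norm vanishes identically on `O[X]/(ω)`. -/
theorem twistNorm_dvd_of_level_absent [IsDomain O] {n : ℕ} {ζ ζi : O} (hζ : ζ * ζi = 1) (hζn : ζi ^ n = 1)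
    {ω : O[X]} (hω : ω * (X - C (ζ - 1)) ∣ (X + 1) ^ n - 1) :
    ω ∣ twistNorm ζi n := by
  have hd0 : (X - C (ζ - 1) : O[X]) ≠ 0 := (monic_X_sub_C (ζ - 1)).ne_zero
  have e : (X + 1) ^ n - 1 = (X - C (ζ - 1)) * (C ζi * twistNorm ζi n) := by
    calc (X + 1) ^ n - 1 = twistGen ζi ^ n - 1 := by rw [twistGen_pow_eq hζn]
      _ = twistNorm ζi n * (twistGen ζi - 1) := by rw [twistNorm_mul_sub_one]
      _ = twistNorm ζi n * (C ζi * (X - C (ζ - 1))) := by rw [twistGen_sub_one hζ]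
      _ = (X - C (ζ - 1)) * (C ζi * twistNorm ζi n) := by ring
  rw [e, mul_comm ω] at hω
  have h1 : ω ∣ C ζi * twistNorm ζi n := (mul_dvd_mul_iff_left hd0).mp hω
  have h2 : twistNorm ζi n = C ζ * (C ζi * twistNorm ζi n) := by
    rw [← mul_assoc, ← C_mul, hζ, C_1, one_mul]
  rw [h2]
  exact dvd_mul_of_dvd_right h1 _

/-- The ideal `(u − 1, ω)` equals `(C (ω(ζ−1)), X − C(ζ−1))`; hence (next lemma)
`A/(u−1)A ≅ O ⧸ (ω(ζ−1))`. -/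
theorem span_twistGen_sub_one_eq {ζ ζi : O} (hζ : ζ * ζi = 1) (ω : O[X]) :
    Ideal.span {twistGen ζi - 1, ω} = Ideal.span {C (ω.eval (ζ - 1)), X - C (ζ - 1)} := by
  have hdec : ω = (X - C (ζ - 1)) * (ω /ₘ (X - C (ζ - 1))) + C (ω.eval (ζ - 1)) := by
    have e := modByMonic_add_div ω (X - C (ζ - 1))
    rw [modByMonic_X_sub_C_eq_C_eval] at e
    linear_combination -e
  have hu : twistGen ζi - 1 = C ζi * (X - C (ζ - 1)) := twistGen_sub_one hζ
  have hu' : X - C (ζ - 1) = C ζ * (twistGen ζi - 1) := (C_mul_twistGen_sub_one hζ).symm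
  apply le_antisymm
  · rw [Ideal.span_le, Set.insert_subset_iff, Set.singleton_subset_iff, SetLike.mem_coe, SetLike.mem_coe]
    refine ⟨?_, ?_⟩
    · rw [hu]
      exact Ideal.mul_mem_left _ _ (Ideal.subset_span (by simp))
    · rw [Ideal.mem_span_pair]
      exact ⟨1, ω /ₘ (X - C (ζ - 1)), by linear_combination -hdec⟩
  · rw [Ideal.span_le, Set.insert_subset_iff, Set.singleton_subset_iff, SetLike.mem_coe, SetLike.mem_coe]
    refine ⟨?_, ?_⟩
    · rw [Ideal.mem_span_pair]
      exact ⟨-(C ζ * (ω /ₘ (X - C (ζ - 1)))), 1, by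
        linear_combination hdec + (ω /ₘ (X - C (ζ - 1))) * hu'⟩
    · rw [hu']
      exact Ideal.mul_mem_left _ _ (Ideal.subset_span (by simp))

/-- `O[X] ⧸ (u − 1, ω) ≃ₐ[O] O ⧸ (ω(ζ−1))`: when the level is absent (`ν̄ = 0`, previous lemma but one) this IS
`H¹(ℤ/n, A(χ)) = A/(u−1)A`, a cyclic `O`-module of length `v(ω(ζ−1))`. -/
noncomputable def quotTwistEquiv {ζ ζi : O} (hζ : ζ * ζi = 1) (ω : O[X]) :
    (O[X] ⧸ Ideal.span {twistGen ζi - 1, ω}) ≃ₐ[O] O ⧸ Ideal.span {ω.eval (ζ - 1)} :=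
  (Ideal.quotientEquivAlgOfEq O (span_twistGen_sub_one_eq hζ ω)).trans
    (Polynomial.quotientSpanCXSubCAlgEquiv (ω.eval (ζ - 1)) (ζ - 1))

/-! ## §4 Instantiation: the signed polynomials `ω_S = ∏_{k∈S} Φ_{p^k}(1+X)` -/

/-- `ω_S := ∏_{k ∈ S} Φ_{p^k}(1 + X)` — for `S = S_ε(m) = {k ≤ m : k ≡ m (mod 2)}` (with or without `0`) this is
Kobayashi's `ω^ε_m` up to the factor `X`, i.e. the relation polynomial of the `ε(m)`-signed local points
(`γ ↦ 1 + X`). -/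
noncomputable def signedOmega (O : Type*) [CommRing O] (p : ℕ) (S : Finset ℕ) : O[X] :=
  ∏ k ∈ S, (cyclotomic (p ^ k) O).comp (X + 1)

theorem signedOmega_eval (p : ℕ) (S : Finset ℕ) (x : O) :
    (signedOmega O p S).eval x = ∏ k ∈ S, (cyclotomic (p ^ k) O).eval (x + 1) := by
  simp [signedOmega, eval_prod, eval_comp]

theorem X_add_one_pow_sub_one_eq_prod {p : ℕ} (hp : 0 < p) (m : ℕ) :
    (X + 1 : O[X]) ^ (p ^ m) - 1 = ∏ i ∈ (p ^ m).divisors, (cyclotomic i O).comp (X + 1) := by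
  have e1 : ((X : O[X]) ^ (p ^ m) - 1).comp (X + 1) = (X + 1) ^ (p ^ m) - 1 := by
    simp only [sub_comp, X_pow_comp, one_comp]
  rw [← e1, ← prod_cyclotomic_eq_X_pow_sub_one (pow_pos hp m) O]
  exact map_prod (compRingHom (X + 1 : O[X])) _ _

/-- `S ⊆ {0,…,m}` ⇒ `ω_S ∣ (1+X)^{p^m} − 1`: the twisted action on `O[X]/(ω_S)` factors through `ℤ/p^m`. -/
theorem signedOmega_dvd {p : ℕ} (hp : 1 < p) {m : ℕ} {S : Finset ℕ} (hS : ∀ k ∈ S, k ≤ m) :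
    signedOmega O p S ∣ (X + 1) ^ (p ^ m) - 1 := by
  have hinj : Set.InjOn (fun k => p ^ k) ↑S := fun a _ b _ hab => Nat.pow_right_injective hp hab
  have e : signedOmega O p S = ∏ i ∈ S.image (fun k => p ^ k), (cyclotomic i O).comp (X + 1) := by
    rw [Finset.prod_image hinj, signedOmega]
  rw [X_add_one_pow_sub_one_eq_prod (lt_trans zero_lt_one hp) m, e]
  apply Finset.prod_dvd_prod_of_subset
  intro i hi
  rw [Finset.mem_image] at hi
  obtain ⟨k, hk, rfl⟩ := hi
  rw [Nat.mem_divisors]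
  exact ⟨pow_dvd_pow p (hS k hk), pow_ne_zero _ (by omega)⟩

/-- `Φ_{p^m}(1+X)` has the root `ζ − 1`. -/
theorem X_sub_C_dvd_cyclotomic_comp [IsDomain O] {p : ℕ} (hp : 0 < p) {m : ℕ} {ζ : O}
    (hζ : IsPrimitiveRoot ζ (p ^ m)) :
    (X - C (ζ - 1)) ∣ (cyclotomic (p ^ m) O).comp (X + 1) := by
  rw [dvd_iff_isRoot, IsRoot.def, eval_comp]
  simp only [eval_add, eval_X, eval_one, sub_add_cancel]
  exact IsPrimitiveRoot.isRoot_cyclotomic (pow_pos hp m) hζ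

/-- Level `m ∈ S` ⇒ `(X − C(ζ−1)) ∣ ω_S` for `ζ` a primitive `p^m`-th root of unity. -/
theorem X_sub_C_dvd_signedOmega [IsDomain O] {p : ℕ} (hp : 0 < p) {m : ℕ} {ζ : O}
    (hζ : IsPrimitiveRoot ζ (p ^ m)) {S : Finset ℕ} (hm : m ∈ S) :
    (X - C (ζ - 1)) ∣ signedOmega O p S :=
  dvd_trans (X_sub_C_dvd_cyclotomic_comp hp hζ) (Finset.dvd_prod_of_mem _ hm)

/-- Level `m ∉ S ⊆ {0,…,m−1}` ⇒ `ω_S · (X − C(ζ−1)) ∣ (1+X)^{p^m} − 1`. -/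
theorem signedOmega_mul_X_sub_C_dvd [IsDomain O] {p : ℕ} (hp : 1 < p) {m : ℕ} {ζ : O}
    (hζ : IsPrimitiveRoot ζ (p ^ m)) {S : Finset ℕ} (hS : ∀ k ∈ S, k < m) :
    signedOmega O p S * (X - C (ζ - 1)) ∣ (X + 1) ^ (p ^ m) - 1 := by
  have hmS : m ∉ S := fun h => lt_irrefl m (hS m h)
  have h1 : signedOmega O p S * (X - C (ζ - 1)) ∣ signedOmega O p (insert m S) := by
    rw [signedOmega, signedOmega, Finset.prod_insert hmS, mul_comm]
    exact mul_dvd_mul (X_sub_C_dvd_cyclotomic_comp (lt_trans zero_lt_one hp) hζ) dvd_rfl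
  refine dvd_trans h1 (signedOmega_dvd hp ?_)
  intro k hk
  rcases Finset.mem_insert.mp hk with rfl | hk
  · exact le_rfl
  · exact (hS k hk).le

theorem mul_pow_pred_eq_one {n : ℕ} (hn : n ≠ 0) {ζ : O} (hζ : ζ ^ n = 1) : ζ * ζ ^ (n - 1) = 1 := by
  rw [mul_pow_sub_one hn, hζ]

theorem pow_pred_pow_eq_one {n : ℕ} {ζ : O} (hζ : ζ ^ n = 1) : (ζ ^ (n - 1)) ^ n = 1 := by
  rw [← pow_mul, mul_comm, pow_mul, hζ, one_pow]

/-- **Signed twist-acyclicity at level `m`** (the statement used on the card): for `p` prime, `ζ` a primitive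
`p^m`-th root of unity in a characteristic-zero domain `O` (e.g. `O_χ = ℤ_p[ζ_{p^m}]`), and any set of levels
`S ⊆ {0,…,m}` CONTAINING `m`, the twisted norm on `A = O[X]/(ω_S)` has kernel `(u−1)A`:
`H¹(ℤ/p^m, (ℤ_p[X]/(ω_S)) ⊗ O(χ)) = 0`.  At `p = 3`, `S = S_{ε(m)}`: the `ε(m)`-signed local points of the
anticyclotomic layer `K_{m,w}` are cohomologically invisible to the primitive characters of level `m`. -/
theorem signedTwistAcyclic_level [IsDomain O] [CharZero O] {p : ℕ} (hp : p.Prime) {m : ℕ} {ζ : O}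
    (hζ : IsPrimitiveRoot ζ (p ^ m)) {S : Finset ℕ} (hS : ∀ k ∈ S, k ≤ m) (hm : m ∈ S)
    (a : O[X] ⧸ Ideal.span {signedOmega O p S})
    (ha : Ideal.Quotient.mk (Ideal.span {signedOmega O p S}) (twistNorm (ζ ^ (p ^ m - 1)) (p ^ m)) * a = 0) :
    ∃ b : O[X] ⧸ Ideal.span {signedOmega O p S},
      a = Ideal.Quotient.mk (Ideal.span {signedOmega O p S}) (twistGen (ζ ^ (p ^ m - 1)) - 1) * b :=
  have hn : p ^ m ≠ 0 := (pow_pos hp.pos m).ne'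
  signedTwistAcyclic_quot (n := p ^ m) (by exact_mod_cast hn) (mul_pow_pred_eq_one hn hζ.pow_eq_one)
    (pow_pred_pow_eq_one hζ.pow_eq_one) (X_sub_C_dvd_signedOmega hp.pos hζ hm)
    (signedOmega_dvd hp.one_lt hS) a ha

/-- **The complementary (defect) case at level `m`**: for `S ⊆ {0,…,m−1}` (level `m` ABSENT — the `−ε(m)`-signed
part seen by a level-`m` character) the twisted norm is identically `0` on `A = O[X]/(ω_S)`, so
`H¹(ℤ/p^m, A(χ)) = A/(u−1)A ≃ O ⧸ (ω_S(ζ−1))` (`quotTwistEquiv`), of length `v(ω_S(ζ−1)) = Σ_{k∈S} v(Φ_{p^k}(ζ))`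
`= Σ_{k ∈ S} φ(p^k)` over `O_χ` (`signedOmega_eval`; one valuation unit per lower-level root, g65 §14) —
for `S = S_{−ε(m)}` this is `kobDefect p m`: the Kobayashi defect IS a local `H¹`. -/
theorem twistNorm_eq_zero_level_absent [IsDomain O] {p : ℕ} (hp : p.Prime) {m : ℕ} {ζ : O}
    (hζ : IsPrimitiveRoot ζ (p ^ m)) {S : Finset ℕ} (hS : ∀ k ∈ S, k < m) :
    Ideal.Quotient.mk (Ideal.span {signedOmega O p S}) (twistNorm (ζ ^ (p ^ m - 1)) (p ^ m)) = 0 := by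
  rw [Ideal.Quotient.eq_zero_iff_mem, Ideal.mem_span_singleton]
  have hn : p ^ m ≠ 0 := (pow_pos hp.pos m).ne'
  exact twistNorm_dvd_of_level_absent (mul_pow_pred_eq_one hn hζ.pow_eq_one) (pow_pred_pow_eq_one hζ.pow_eq_one)
    (signedOmega_mul_X_sub_C_dvd hp.one_lt hζ hS)

/-! ## §5 Print cross-check: Kurihara's `e_n` and the Kobayashi defect -/

/-- Verbatim copy of g65 §13 `OnePointSqueeze.kobDefect` (that Cruxes module is outside the farm build graph, so it
cannot be imported here): `kobDefect p n = Σ_{1 ≤ k < n, k ≢ n (mod 2)} φ(p^k)` — the length of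
(isotypic line)/(resolvent line) in the level-`n` layer of Kobayashi's model. -/
def kobDefect' (p n : ℕ) : ℕ := ∑ k ∈ Finset.Ico 1 n, if k % 2 = n % 2 then 0 else Nat.totient (p ^ k)

theorem sum_Ico_one_add_two {M : Type*} [AddCommMonoid M] (f : ℕ → M) {n : ℕ} (hn : 1 ≤ n) :
    ∑ k ∈ Finset.Ico 1 (n + 2), f k = ∑ k ∈ Finset.Ico 1 n, f k + f n + f (n + 1) := by
  rw [Finset.sum_Ico_succ_top (by omega : 1 ≤ n + 1), Finset.sum_Ico_succ_top hn]

theorem kobDefect'_add_two (p n : ℕ) : kobDefect' p (n + 2) = kobDefect' p n + Nat.totient (p ^ (n + 1)) := by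
  unfold kobDefect'
  rcases Nat.eq_zero_or_pos n with rfl | hn
  · have h1 : Finset.Ico 1 (0 + 2) = {1} := by decide
    simp [h1]
  · rw [sum_Ico_one_add_two _ hn]
    simp only [show (n + 2) % 2 = n % 2 by omega]
    have h3 : ¬ ((n + 1) % 2 = n % 2) := by omega
    simp [h3]

/-- Kurihara's exponent: `#Ш(E/ℚ_n)[p^∞] = p^{e_n}`, `e_n = p^{n−1} + p^{n−3} + ⋯ − ⌊n/2⌋`
[Kurihara, Invent. Math. 149 (2002) 195–224, Thm 0.1(3); Rem 0.2(1): `e_n = [μ pⁿ + λ n]`, `μ = p/(p²−1)`,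
`λ = −1/2`] (minimal case: `ord_p(L(E,1)/Ω) = 0`, `p ∤ Tam`, `ρ_{E,p}` surjective, `p` odd supersingular). -/
def kuriharaExponent (p n : ℕ) : ℤ :=
  (∑ k ∈ Finset.Ico 1 n, if k % 2 = n % 2 then (0 : ℤ) else (p : ℤ) ^ k) - (n / 2 : ℕ)

theorem kuriharaSum_add_two (p n : ℕ) :
    (∑ k ∈ Finset.Ico 1 (n + 2), if k % 2 = (n + 2) % 2 then (0 : ℤ) else (p : ℤ) ^ k) =
      (∑ k ∈ Finset.Ico 1 n, if k % 2 = n % 2 then (0 : ℤ) else (p : ℤ) ^ k) + (p : ℤ) ^ (n + 1) := by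
  rcases Nat.eq_zero_or_pos n with rfl | hn
  · have h1 : Finset.Ico 1 (0 + 2) = {1} := by decide
    simp [h1]
  · rw [sum_Ico_one_add_two _ hn]
    simp only [show (n + 2) % 2 = n % 2 by omega]
    have h3 : ¬ ((n + 1) % 2 = n % 2) := by omega
    simp [h3]

theorem kuriharaExponent_values_three :
    kuriharaExponent 3 0 = 0 ∧ kuriharaExponent 3 1 = 0 ∧ kuriharaExponent 3 2 = 2 ∧
      kuriharaExponent 3 3 = 8 ∧ kuriharaExponent 3 4 = 28 ∧ kuriharaExponent 3 5 = 88 := by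
  simp only [kuriharaExponent]
  decide

/-- **Kurihara increment = Kobayashi defect**: `e_{n+1} − e_n = kobDefect p (n+1)` for every prime `p` and
every `n`.  (So the per-primitive-character length of the Bloch–Kato Ш in the `n`-th cyclotomic layer of
Kurihara's minimal supersingular example is EXACTLY the defect `d_χ` of g65 §13 / the local `H¹` of §3 above;
`kobDefect p n / φ(p^n) → p/(p²−1)` = Kurihara's `μ`.) -/
theorem kuriharaExponent_succ_sub (p : ℕ) (hp : p.Prime) (n : ℕ) :
    kuriharaExponent p (n + 1) - kuriharaExponent p n = kobDefect' p (n + 1) := by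
  induction n using Nat.twoStepInduction with
  | zero =>
    simp [kuriharaExponent, kobDefect']
  | one =>
    have h1 : Finset.Ico 1 2 = {1} := by decide
    have hc : ((p - 1 : ℕ) : ℤ) = (p : ℤ) - 1 := by have := hp.one_lt; omega
    simp [kuriharaExponent, kobDefect', h1, Nat.totient_prime hp, hc]
  | more n ih1 _ =>
    have eK2 : kuriharaExponent p (n + 2) = kuriharaExponent p n + (p : ℤ) ^ (n + 1) - 1 := by
      simp only [kuriharaExponent, kuriharaSum_add_two]
      have : ((n + 2) / 2 : ℕ) = n / 2 + 1 := by omega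
      rw [this]; push_cast; ring
    have eK3 : kuriharaExponent p (n + 3) = kuriharaExponent p (n + 1) + (p : ℤ) ^ (n + 2) - 1 := by
      have e := kuriharaSum_add_two p (n + 1)
      simp only [kuriharaExponent]
      rw [show n + 3 = n + 1 + 2 by rfl, e]
      have : ((n + 1 + 2) / 2 : ℕ) = (n + 1) / 2 + 1 := by omega
      rw [this]; push_cast; ring
    have eD : kobDefect' p (n + 3) = kobDefect' p (n + 1) + Nat.totient (p ^ (n + 2)) := kobDefect'_add_two p (n + 1)
    rw [show n + 2 + 1 = n + 3 by rfl, eK3, eK2, eD, Nat.totient_prime_pow_succ hp]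
    have hc : ((p - 1 : ℕ) : ℤ) = (p : ℤ) - 1 := by have := hp.one_lt; omega
    push_cast
    rw [hc]
    linear_combination ih1

end Summit.BirchSwinnertonDyer.BirchSwinnertonDyer.Cruxes.TwinAlgMuZeroAtThree.OnePointSqueeze.SignedAcyclicity
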